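import Literature.AnabelianGeometry.SemiGraphs.ProSigmaCuspInertiaDisjoint
import Mathlib.GroupTheory.RegularWreathProduct
import Mathlib.GroupTheory.FreeGroup.IsFreeGroup
import Mathlib.Data.Nat.Factorization.Basic
import Mathlib.Topology.Algebra.OpenSubgroup
import HarnessLib

/-!
# The wreath-product obstruction to commuting with a power of a lifted generator

Finite-group engine for the MALNORMALITY clause of abc-iut-L3-t11's named fact
`ProSigmaCuspInertiaMalnormal` ([SemiAnbd] Example 2.10 p. 31 / [AbsAnab] Lemma 1.3.7, the input of
"totally estranged") [cite: MochizukiSemiAnbd2006, Ex. 2.10 p.31]; consumed by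
`ProSigmaCompletionMalnormal.lean`.  For a finite group `Q`, an element `c ∈ Q` and the wreath product
`W = C_M ≀ Q` (Mathlib `RegularWreathProduct`), lift `c` to `ĉ = (δ_1, c)` (`δ_1` the indicator of the
identity in the base `Q → C_M`):

* `wreath_indicator_pow` — the `q`-coordinate of `ĉ^n` counts the `i < n` with `q = c^i`;
* `natCast_eq_zero_of_commute_wreath_pow` — **the obstruction**: if `(u, x)` commutes with `ĉ^n` and
  `x ∉ ⟨c⟩`, then `M ∣ n` (sum the coordinates of the commutation identity over the coset `⟨c⟩`: the
  `u`-terms cancel, the `x`-translate of `ĉ^n` has no support on `⟨c⟩`, the coordinates of `ĉ^n` on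
  `⟨c⟩` add up to `n`);
* `isSigmaInteger_card_wreath_of` — `|C_M ≀ Q|` is a `Σ`-integer when `M` and `|Q|` are;
* small helpers: `FreeGroupBasis.lift_apply_basis`, `exists_ordProj_not_dvd` (a prime power
  `p^{v_p m} ∤ a` when `m ∤ a`), `map_topologicalClosure_zpowers_le` (a continuous homomorphism to a
  discrete group maps `closure ⟨t⟩` into `⟨image of t⟩`).

Theorems only; elementary finite group theory; no side is taken on [IUTchIII] Cor. 3.12.
-/

namespace Literature.AnabelianGeometry.SemiGraphs.SemiGraphOfAnabelioids.IsProSigmaCompletion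

open Literature.AnabelianGeometry.Anabelioids Topology Multiplicative
open scoped Pointwise

/-! ### The finite engine: commuting with a power of `(δ_1, c)` in `C_M ≀ Q` -/

section Wreath

variable {Q : Type*} [Group Q] [DecidableEq Q] {M : ℕ}

/-- Powers of the lift `ĉ = (δ_1, c)` of `c` to the wreath product `C_M ≀ Q`: the `q`-coordinate of
`ĉ^n` counts the `i < n` with `q = c^i`. [cite: MochizukiSemiAnbd2006, Ex. 2.10 p.31] -/
theorem wreath_indicator_pow (c : Q) (n : ℕ) :
    ((⟨fun q => if q = 1 then ofAdd (1 : ZMod M) else 1, c⟩ : Multiplicative (ZMod M) ≀ᵣ Q) ^ n) =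
      ⟨fun q => ofAdd (∑ i ∈ Finset.range n, if q = c ^ i then (1 : ZMod M) else 0), c ^ n⟩ := by
  induction n with
  | zero =>
    ext q
    · simp
    · simp
  | succ n ih =>
    rw [pow_succ, ih]
    ext q
    · simp only [RegularWreathProduct.mul_left, Pi.mul_apply, Finset.sum_range_succ, ofAdd_add]
      congr 1
      by_cases h : q = c ^ n
      · subst h
        simp
      · rw [if_neg, if_neg h, ofAdd_zero]
        intro h'
        exact h (inv_mul_eq_one.mp h').symm
    · simp [pow_succ]

/-- **The wreath obstruction.**  In `C_M ≀ Q` with `ĉ = (δ_1, c)`: if an element `(u, x)` with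
`x ∉ ⟨c⟩` commutes with `ĉ^n`, then `M ∣ n`.  (Sum the `C_M`-coordinates of the commutation identity
over the coset `⟨c⟩ ⊆ Q`: the `u`-terms cancel, the `x`-translate of `ĉ^n` has no support on `⟨c⟩`, and
the coordinates of `ĉ^n` on `⟨c⟩` add up to `n`.) [cite: MochizukiSemiAnbd2006, Ex. 2.10 p.31] -/
theorem natCast_eq_zero_of_commute_wreath_pow [Fintype Q] (c x : Q) (hx : x ∉ Subgroup.zpowers c)
    (u : Q → Multiplicative (ZMod M)) (n : ℕ)
    (h : Commute (⟨u, x⟩ : Multiplicative (ZMod M) ≀ᵣ Q)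
      (⟨fun q => if q = 1 then ofAdd (1 : ZMod M) else 1, c⟩ ^ n)) :
    (n : ZMod M) = 0 := by
  classical
  rw [wreath_indicator_pow] at h
  set F : Q → ZMod M := fun q => ∑ i ∈ Finset.range n, if q = c ^ i then (1 : ZMod M) else 0
    with hF
  -- the commutation identity, coordinate by coordinate
  have hq : ∀ q, toAdd (u q) + F (x⁻¹ * q) = F q + toAdd (u ((c ^ n)⁻¹ * q)) := by
    intro q
    have := congrArg (fun w : Multiplicative (ZMod M) ≀ᵣ Q => toAdd (w.left q)) h.eq
    simp only [RegularWreathProduct.mul_left, Pi.mul_apply, toAdd_mul, toAdd_ofAdd] at this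
    exact this
  -- sum over the coset `S = ⟨c⟩`
  set S : Finset Q := Finset.univ.filter fun q => q ∈ Subgroup.zpowers c with hS
  have hmemS : ∀ q, q ∈ S ↔ q ∈ Subgroup.zpowers c := fun q => by simp [hS]
  have hsum := Finset.sum_congr rfl fun q (_ : q ∈ S) => hq q
  rw [Finset.sum_add_distrib, Finset.sum_add_distrib] at hsum
  -- (i) the `u`-terms agree
  have h1 : ∑ q ∈ S, toAdd (u ((c ^ n)⁻¹ * q)) = ∑ q ∈ S, toAdd (u q) := by
    refine Finset.sum_bijective (fun q => (c ^ n)⁻¹ * q) (Group.mulLeft_bijective _) (fun q => ?_)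
      (fun q _ => rfl)
    rw [hmemS, hmemS]
    have hc : (c ^ n)⁻¹ ∈ Subgroup.zpowers c := Subgroup.inv_mem _ (Subgroup.pow_mem _ (Subgroup.mem_zpowers c) n)
    constructor
    · exact fun hq' => Subgroup.mul_mem _ hc hq'
    · intro hq'
      have := Subgroup.mul_mem _ (Subgroup.inv_mem _ hc) hq'
      rwa [inv_mul_cancel_left] at this
  -- (ii) the coordinates of `ĉ^n` over `S` add up to `n`
  have h2 : ∑ q ∈ S, F q = n := by
    simp only [hF]
    rw [Finset.sum_comm]
    have : ∀ i ∈ Finset.range n, (∑ q ∈ S, if q = c ^ i then (1 : ZMod M) else 0) = 1 := by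
      intro i _
      rw [Finset.sum_ite_eq']
      rw [if_pos ((hmemS _).mpr (Subgroup.pow_mem _ (Subgroup.mem_zpowers c) i))]
    rw [Finset.sum_congr rfl this]
    simp
  -- (iii) the `x`-translate has no support on `S`
  have h3 : ∑ q ∈ S, F (x⁻¹ * q) = 0 := by
    refine Finset.sum_eq_zero fun q hqS => Finset.sum_eq_zero fun i _ => ?_
    rw [if_neg]
    intro hxq
    apply hx
    have hq' : q ∈ Subgroup.zpowers c := (hmemS q).mp hqS
    have : x = q * (c ^ i)⁻¹ := by
      rw [← hxq]
      group
    rw [this]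
    exact Subgroup.mul_mem _ hq' (Subgroup.inv_mem _ (Subgroup.pow_mem _ (Subgroup.mem_zpowers c) i))
  rw [h1, h2, h3, add_zero] at hsum
  -- `A = n + A`
  have hsum' : (0 : ZMod M) + ∑ q ∈ S, toAdd (u q) = (n : ZMod M) + ∑ q ∈ S, toAdd (u q) := by
    rw [zero_add]; exact hsum
  exact (add_right_cancel hsum').symm

omit [Group Q] [DecidableEq Q] in
/-- The order of `C_M ≀ Q` is a `Σ`-integer when `M` and `|Q|` are.
[cite: MochizukiSemiAnbd2006, Ex. 2.10 p.31] -/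
theorem isSigmaInteger_card_wreath_of {Sigma : Set ℕ} [Group Q] [Finite Q] (hM : IsSigmaInteger Sigma M)
    (hQ : IsSigmaInteger Sigma (Nat.card Q)) :
    IsSigmaInteger Sigma (Nat.card (Multiplicative (ZMod M) ≀ᵣ Q)) := by
  haveI : NeZero M := ⟨hM.1.ne'⟩
  rw [RegularWreathProduct.card]
  have hc : Nat.card (Multiplicative (ZMod M)) = M := Nat.card_zmod M
  rw [hc]
  refine ⟨Nat.mul_pos (Nat.pow_pos hM.1) hQ.1, fun q hq hdvd => ?_⟩
  rcases (Nat.Prime.dvd_mul hq).mp hdvd with h | h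
  · exact hM.2 q hq (hq.dvd_of_dvd_pow h)
  · exact hQ.2 q hq h

end Wreath

/-! ### Malnormality in the pro-`Σ` completion -/

variable {Sigma : Set ℕ} {Γ : Type*} [Group Γ] {P : Type*} [Group P] [TopologicalSpace P]
  {ι : Γ →* P}

/-- Evaluation of the homomorphism determined by a free basis on a basis element. [cite: MochizukiSemiAnbd2006, Ex. 2.10 p.31] -/
theorem _root_.FreeGroupBasis.lift_apply_basis {β H : Type*} [Group H] (b : FreeGroupBasis β Γ)
    (f : β → H) (i : β) : b.lift f (b i) = f i := by
  change FreeGroup.lift f (b.repr (b i)) = f i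
  rw [FreeGroupBasis.repr_apply_coe, FreeGroup.lift_apply_of]

/-- A prime power `p^{v_p(m)} ∥ m` not dividing `a`, when `m ∤ a` (`m ≠ 0`). [cite: MochizukiSemiAnbd2006, Ex. 2.10 p.31] -/
theorem exists_ordProj_not_dvd {m a : ℕ} (hm : m ≠ 0) (hma : ¬ m ∣ a) :
    ∃ p : ℕ, p.Prime ∧ 0 < m.factorization p ∧ ¬ p ^ m.factorization p ∣ a := by
  by_contra hcon
  push Not at hcon
  apply hma
  by_cases ha0 : a = 0
  · simp [ha0]
  rw [← Nat.factorization_le_iff_dvd hm ha0]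
  intro q
  by_cases hq : q.Prime
  · by_cases h0 : m.factorization q = 0
    · simp [h0]
    · exact (hq.pow_dvd_iff_le_factorization ha0).mp (hcon q hq (Nat.pos_of_ne_zero h0))
  · simp [Nat.factorization_eq_zero_of_not_prime _ hq]

/-- The image of the closure of `⟨t⟩` under a continuous homomorphism to a discrete group lies in the
cyclic group generated by the image of `t`. [cite: MochizukiSemiAnbd2006, Ex. 2.10 p.31] -/
theorem map_topologicalClosure_zpowers_le [IsTopologicalGroup P] {W : Type*} [Group W] [TopologicalSpace W]
    [DiscreteTopology W] (ψ : P →* W) (hψ : Continuous ψ) (t : P) :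
    (Subgroup.zpowers t).topologicalClosure.map ψ ≤ Subgroup.zpowers (ψ t) := by
  rw [Subgroup.map_le_iff_le_comap]
  refine Subgroup.topologicalClosure_minimal _ ?_ ?_
  · rw [← Subgroup.map_le_iff_le_comap, MonoidHom.map_zpowers]
  · change IsClosed (ψ ⁻¹' (Subgroup.zpowers (ψ t) : Set W))
    exact (isClosed_discrete _).preimage hψ

end Literature.AnabelianGeometry.SemiGraphs.SemiGraphOfAnabelioids.IsProSigmaCompletion
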